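/-
Copyright (c) 2026. All rights reserved.
Released under Apache 2.0 license as described in the file LICENSE.
Authors: abc-iut cell, wave-2 seat abc-iut-L3-t11 (proof-only; towards the real instance of
abc-iut-L4-t2's `GaloisPadicLog`, [AbsTopIII] Def 3.1 (iv)).
-/
import Mathlib.NumberTheory.Padics.ValuativeRel
import Mathlib.NumberTheory.Padics.Complex
import Mathlib.Analysis.Normed.Unbundled.SpectralNorm
import Mathlib.RingTheory.Polynomial.Subring
import Literature.AnabelianGeometry.AbsoluteAnabelian.MLFGaloisModel
import Literature.NumberTheory.GaloisRepresentations.LocalFieldPadicProofs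
import HarnessLib

/-!
# `𝒪_{ℚ̄_p}` and `𝒪_{ℚ̄_p}^×` of [AbsTopIII] Def 3.1 (i) versus the spectral norm on `ℚ̄_p = PadicAlgCl p`

S. Mochizuki, *Topics in absolute anabelian geometry III*, J. Math. Sci. Univ. Tokyo 22 (2015)
[MochizukiAbsTopIII2015], Def 3.1 (i), manuscript p. 66: for an MLF `k` with algebraic closure `k̄`,
"`𝒪_k̄` … the ring of integers of `k̄`", "`𝒪_k̄^×` … the group of units".

Seat abc-iut-L4-t2 (`MLFGaloisModel.lean`, p405133) typed these ALGEBRAICALLY over a valued base field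
(`[ValuativeRel k]`): `integersClosure k K` = the integral closure of the valuation ring `𝒪[k]` in `K`,
`unitSubmonoid k K` = its elements with an inverse in it. This PROOF-ONLY file identifies them, for
`k = ℚ_p` (Mathlib's `ValuativeRel ℚ_[p]`) and `K = ℚ̄_p = PadicAlgCl p` (normed by the spectral norm
extending `|·|_p`), with the NORM-side objects used by the cell's analytic files:

* (`x ∈ 𝒪[ℚ_p] ↔ ‖x‖ ≤ 1` is the TREE's `Literature.NumberTheory.GaloisRepresentations.Padic.mem_valuationInteger_iff`);
* `PadicAlgCl.norm_le_one_of_isIntegral` / `PadicAlgCl.isIntegral_of_norm_le_one` —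
  **`x ∈ ℚ̄_p` is integral over `𝒪[ℚ_p] = ℤ_p` iff `‖x‖ ≤ 1`** (`→`: a root of a monic polynomial with
  coefficients of norm `≤ 1` has spectral norm `≤ 1`, Mathlib `norm_root_le_spectralValue` +
  `spectralValue_le_one_iff`; `←`: `‖x‖ = spectralValue (minpoly_{ℚ_p} x) ≤ 1` forces all coefficients of
  the minimal polynomial into `𝒪[ℚ_p]`, Mathlib `spectralValue_le_one_iff`, `Polynomial.toSubring`);
* `PadicAlgCl.mem_integersClosure_iff`, `PadicAlgCl.mem_unitSubmonoid_iff` — hence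
  `𝒪_{ℚ̄_p} = {‖x‖ ≤ 1}` and **`𝒪_{ℚ̄_p}^× = {‖x‖ = 1}`**.

Classical (Bosch–Güntzer–Remmert 3.1.2/1); no definitions; nothing here is disputed.
-/

set_option autoImplicit false

noncomputable section

namespace Literature.AnabelianGeometry.AbsoluteAnabelian

open Polynomial
open scoped ValuativeRel

variable {p : ℕ} [hp : Fact p.Prime]

/-! ## `𝒪[ℚ_p]` is the closed unit ball: the tree's `Padic.mem_valuationInteger_iff` -/

/-- The embedding `𝒪[ℚ_p] → ℚ̄_p` factors through `ℚ_p` (scalar tower), so that polynomials over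
`𝒪[ℚ_p]` evaluate in `ℚ̄_p` through their images over `ℚ_p`. [cite: MochizukiAbsTopIII2015, Definition 3.1 (i) p.66] -/
theorem PadicAlgCl.aeval_map_valuationInteger (x : PadicAlgCl p) (f : (𝒪[ℚ_[p]])[X]) :
    aeval x (f.map (algebraMap (𝒪[ℚ_[p]]) ℚ_[p])) = aeval x f :=
  aeval_map_algebraMap ℚ_[p] x f

/-! ## Integrality over `𝒪[ℚ_p]` versus the spectral norm -/

/-- **`→`**: an element of `ℚ̄_p` integral over `𝒪[ℚ_p]` has norm `≤ 1` (it is a root of a monic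
polynomial all of whose coefficients have norm `≤ 1`, so its spectral norm is `≤ 1`:
Bosch–Güntzer–Remmert 3.1.2/1). [cite: MochizukiAbsTopIII2015, Definition 3.1 (i) p.66] -/
theorem PadicAlgCl.norm_le_one_of_isIntegral {x : PadicAlgCl p} (hx : IsIntegral (𝒪[ℚ_[p]]) x) :
    ‖x‖ ≤ 1 := by
  obtain ⟨f, hf, hfx⟩ := hx
  set g : ℚ_[p][X] := f.map (algebraMap (𝒪[ℚ_[p]]) ℚ_[p]) with hg
  have hgm : g.Monic := hf.map _
  have hgx : aeval x g = 0 := by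
    rw [hg, PadicAlgCl.aeval_map_valuationInteger]
    exact hfx
  have hcoef : ∀ n : ℕ, ‖g.coeff n‖ ≤ 1 := fun n => by
    rw [hg, coeff_map]
    exact (Literature.NumberTheory.GaloisRepresentations.Padic.mem_valuationInteger_iff p _).mp (f.coeff n).2
  have h1 : spectralValue g ≤ 1 := (spectralValue_le_one_iff hgm).mpr hcoef
  have h2 : spectralAlgNorm ℚ_[p] (PadicAlgCl p) x ≤ spectralValue g :=
    norm_root_le_spectralValue spectralAlgNorm_isPowMul isNonarchimedean_spectralNorm hgm hgx
  rw [← PadicAlgCl.spectralNorm_eq]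
  exact h2.trans h1

/-- **`←`**: an element of `ℚ̄_p` of norm `≤ 1` is integral over `𝒪[ℚ_p]` (its norm IS the spectral
value of its minimal polynomial over `ℚ_p`, so every coefficient of the latter has norm `≤ 1`).
[cite: MochizukiAbsTopIII2015, Definition 3.1 (i) p.66] -/
theorem PadicAlgCl.isIntegral_of_norm_le_one {x : PadicAlgCl p} (hx : ‖x‖ ≤ 1) :
    IsIntegral (𝒪[ℚ_[p]]) x := by
  have hint : IsIntegral ℚ_[p] x := Algebra.IsIntegral.isIntegral x
  have hm : (minpoly ℚ_[p] x).Monic := minpoly.monic hint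
  have hsv : spectralValue (minpoly ℚ_[p] x) ≤ 1 := by
    rw [← PadicAlgCl.spectralNorm_eq] at hx
    exact hx
  have hc : ∀ n : ℕ, ‖(minpoly ℚ_[p] x).coeff n‖ ≤ 1 := (spectralValue_le_one_iff hm).mp hsv
  have hsub : (↑(minpoly ℚ_[p] x).coeffs : Set ℚ_[p]) ⊆ ((𝒪[ℚ_[p]] : Subring ℚ_[p]) : Set ℚ_[p]) := by
    intro c hc'
    obtain ⟨n, -, rfl⟩ := mem_coeffs_iff.mp (Finset.mem_coe.mp hc')
    exact (Literature.NumberTheory.GaloisRepresentations.Padic.mem_valuationInteger_iff p _).mpr (hc n)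
  refine ⟨(minpoly ℚ_[p] x).toSubring _ hsub, (monic_toSubring _ _ _).mpr hm, ?_⟩
  have hmap : ((minpoly ℚ_[p] x).toSubring _ hsub).map (algebraMap (𝒪[ℚ_[p]]) ℚ_[p]) =
      minpoly ℚ_[p] x := by
    ext n
    rw [coeff_map]
    exact coeff_toSubring _ _ hsub
  change aeval x ((minpoly ℚ_[p] x).toSubring _ hsub) = 0
  rw [← PadicAlgCl.aeval_map_valuationInteger, hmap, minpoly.aeval]

/-- `x ∈ ℚ̄_p` is integral over `𝒪[ℚ_p]` iff `‖x‖ ≤ 1`. [cite: MochizukiAbsTopIII2015, Definition 3.1 (i) p.66] -/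
theorem PadicAlgCl.isIntegral_iff_norm_le_one (x : PadicAlgCl p) :
    IsIntegral (𝒪[ℚ_[p]]) x ↔ ‖x‖ ≤ 1 :=
  ⟨PadicAlgCl.norm_le_one_of_isIntegral, PadicAlgCl.isIntegral_of_norm_le_one⟩

/-! ## `𝒪_{ℚ̄_p}` and `𝒪_{ℚ̄_p}^×` of Def 3.1 (i) -/

/-- **`𝒪_{ℚ̄_p} = {‖x‖ ≤ 1}`**: abc-iut-L4-t2's `integersClosure ℚ_[p] (PadicAlgCl p)` is the closed unit
ball of the spectral norm. [cite: MochizukiAbsTopIII2015, Definition 3.1 (i) p.66] -/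
theorem PadicAlgCl.mem_integersClosure_iff (x : PadicAlgCl p) :
    x ∈ integersClosure ℚ_[p] (PadicAlgCl p) ↔ ‖x‖ ≤ 1 := by
  rw [integersClosure, mem_integralClosure_iff]
  exact PadicAlgCl.isIntegral_iff_norm_le_one x

/-- **`𝒪_{ℚ̄_p}^× = {‖x‖ = 1}`**: abc-iut-L4-t2's `unitSubmonoid ℚ_[p] (PadicAlgCl p)` is the unit
sphere of the spectral norm. [cite: MochizukiAbsTopIII2015, Definition 3.1 (i) p.66] -/
theorem PadicAlgCl.mem_unitSubmonoid_iff (x : PadicAlgCl p) :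
    x ∈ unitSubmonoid ℚ_[p] (PadicAlgCl p) ↔ ‖x‖ = 1 := by
  constructor
  · rintro ⟨hx, y, hy, hxy⟩
    have h1 : ‖x‖ ≤ 1 := (PadicAlgCl.mem_integersClosure_iff x).mp hx
    have h2 : ‖y‖ ≤ 1 := (PadicAlgCl.mem_integersClosure_iff y).mp hy
    have h12 : ‖x‖ * ‖y‖ = 1 := by rw [← norm_mul, hxy, norm_one]
    exact le_antisymm h1 (by nlinarith [norm_nonneg x, norm_nonneg y])
  · intro hx
    have hx0 : x ≠ 0 := norm_pos_iff.mp (by rw [hx]; exact one_pos)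
    refine ⟨(PadicAlgCl.mem_integersClosure_iff x).mpr hx.le, x⁻¹,
      (PadicAlgCl.mem_integersClosure_iff _).mpr (by rw [norm_inv, hx, inv_one]), mul_inv_cancel₀ hx0⟩

/-- A unit of `𝒪_{ℚ̄_p}` is non-zero. [cite: MochizukiAbsTopIII2015, Definition 3.1 (i) p.66] -/
theorem PadicAlgCl.ne_zero_of_mem_unitSubmonoid {x : PadicAlgCl p}
    (hx : x ∈ unitSubmonoid ℚ_[p] (PadicAlgCl p)) : x ≠ 0 :=
  norm_pos_iff.mp (by rw [(PadicAlgCl.mem_unitSubmonoid_iff x).mp hx]; exact one_pos)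

end Literature.AnabelianGeometry.AbsoluteAnabelian

end
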